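import Literature.NumberTheory.Rogawski1990.ArchPlaneSL2Model   -- ★ p848570 (T1): `archPlaneLift`, `archPlaneLift_mul`, `archPlaneLift_unitary`, `hs_archPlaneLift`
import Literature.MeasureTheory.Group.SL2IwasawaHaar             -- ★ `iwasawaMeasure`, `map_mul_left_iwasawaMeasure`, `iwasawaMeasure_compl_det_one`, `measurable_mul_left`
import Mathlib.MeasureTheory.Group.Measure
import HarnessLib

/-!
# A reference Haar measure of `U(Φ₂)(ℂ) ≅ U(1,1)` on `M₂(ℂ)` through the `S¹ × SL₂(ℝ)` model, and the EXACT transfer of Hilbert–Schmidt ball volumes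
# (organ (T2), steps (a)–(d), of the (VOL)-plumbing behind the `stub_N9` pay-down line, LH3; Beuzart-Plessis 2020 §1.5, Borel 1997 §4.1, Lang *SL₂(ℝ)*)

Topic `NumberTheory/Rogawski1990`; namespace `Literature.NumberTheory.Rogawski1990`.  ONE definition with body (`archPlaneLiftMeasure`) + theorems; no instance, no
notation, no named fact, no `sorry`.  Cell `pub/hodgecm-mathlib`, F0∕P3c line LH3 (crux H413 = `stmt-HodgeConjecture-24833`); seat LH3-p02 (g0), deal #7 of
LH3-plan (g0); lane `--supports stmt-HodgeConjecture-24833`.  HONEST LABEL: HC_CM is proved only modulo the 7 printed citations (2 remaining: hLiu418 =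
stmt-HodgeConjecture-24832, h413 = stmt-HodgeConjecture-24833) until rung 0 closes; this file is measure bookkeeping in the AMBIENT currency of ★ `SL2IwasawaHaar`
(measures on matrix spaces) and pays no printed statement — it carries LH3-p04's `SL₂(ℝ)` volume growth (VOL-grp-SL2) to the factor `U(Φ₂)(ℂ)_w ≅ U(1,1)` of
`H_∞`, input of (T3) «places multiply» (LH3-p03) and of ★ p848470 (CONV).

THE MATHEMATICS.  By ★ `ArchPlaneSL2Model` (T1), `U(Φ₂)(ℂ) = {z · D r D⁻¹ ∣ z ∈ S¹, r ∈ SL₂(ℝ)}` with the lift `archPlaneLift` multiplicative, `2 : 1`, and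
ISOMETRIC for the Hilbert–Schmidt norm.  Hence the push-forward `archPlaneLiftMeasure μ` of `μ ⊗ iwasawaMeasure` (`μ` a finite left-invariant measure on `S¹`,
★ `iwasawaMeasure` = the Haar measure `y⁻² dx dy dθ` of `SL₂(ℝ)` on `M₂(ℝ)` [Lang, *SL₂(ℝ)*, III §1; ★ `SL2IwasawaHaar`]) is a measure on `M₂(ℂ)` which is
(b) EXACT on HS-balls: `archPlaneLiftMeasure μ {Σ|y_ij|² ≤ ρ} = μ(S¹) · iwasawaMeasure {Σ r_ij² ≤ ρ}` — so the linear growth of [BeuzartPlessis2020Asterisque,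
§1.5 (1.5.2)–(1.5.3)] for `SL₂(ℝ)` passes to `U(1,1)` with the same exponent; (c) LEFT-INVARIANT under every lift `archPlaneLift z₀ r₀` (`|z₀| = 1`,
`det r₀ = 1`), i.e. under `U(Φ₂)(ℂ)` (★ `exists_archPlaneLift_eq_of_unitary`); (d) CARRIED by the `Φ₂`-unitary matrices.  RESIDUAL (T2e), NOT in this file: «every
Haar measure on the closed subgroup `↥(unitaryGroupOfForm (starRingEnd ℂ) Φ₂) ≤ GL₂(ℂ)` is a constant multiple of the pull-back of `archPlaneLiftMeasure`»
(uniqueness of Haar measure + the closed embedding `U(Φ₂)(ℂ) ↪ M₂(ℂ)`), which turns (b) into the subtype-level statement «(T2-out)».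
* §1 `continuous_archPlaneLift_uncurry`, `archPlaneLiftMeasure`, `measurableSet_hsBall_complex ∕ _real`, **`archPlaneLiftMeasure_hsBall`** (b),
  **`map_mul_left_archPlaneLiftMeasure`** (c), `measurableSet_archPlane_unitary`, **`archPlaneLiftMeasure_compl_unitary`** (d).

## References
* [BeuzartPlessis2020Asterisque] R. Beuzart-Plessis, Astérisque 418 (2020), §1.5 (1.5.2)–(1.5.3) p. 31 (growth of `Ξ`, volumes of balls).
* [Borel1997] A. Borel, *Automorphic Forms on SL₂(ℝ)*, Cambridge Tracts in Math. 130 (1997), §4.1 (1)–(3) p. 48 (`SU(1,1) = T SL₂(ℝ) T⁻¹`), §2.3 (Iwasawa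
  decomposition, Haar measure of `SL₂(ℝ)`).
* [Rogawski1990] J. D. Rogawski, *Automorphic Representations of Unitary Groups in Three Variables*, Ann. of Math. Stud. 123 (1990), §3.1 p. 19.
-/

set_option autoImplicit false

noncomputable section

open Complex MeasureTheory Literature.MeasureTheory.Group
open scoped Matrix ComplexConjugate

namespace Literature.NumberTheory.Rogawski1990

/-! ## §1 The reference measure on `M₂(ℂ)` carried by `U(Φ₂)(ℂ)`: push-forward of `μ_{S¹} ⊗ (y⁻² dx dy dθ)` along the lift -/

section Ambient

variable [MeasurableSpace (Matrix (Fin 2) (Fin 2) ℝ)] [BorelSpace (Matrix (Fin 2) (Fin 2) ℝ)]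
  [MeasurableSpace (Matrix (Fin 2) (Fin 2) ℂ)] [BorelSpace (Matrix (Fin 2) (Fin 2) ℂ)]
  [MeasurableSpace Circle] [BorelSpace Circle]

omit [MeasurableSpace (Matrix (Fin 2) (Fin 2) ℝ)] [BorelSpace (Matrix (Fin 2) (Fin 2) ℝ)] [MeasurableSpace (Matrix (Fin 2) (Fin 2) ℂ)]
  [BorelSpace (Matrix (Fin 2) (Fin 2) ℂ)] [MeasurableSpace Circle] [BorelSpace Circle] in
/-- The lift `S¹ × M₂(ℝ) → M₂(ℂ)`, `(z, r) ↦ archPlaneLift z r`, is continuous. [cite: Borel1997, §4.1 (1)–(3)] -/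
theorem continuous_archPlaneLift_uncurry :
    Continuous fun p : Circle × Matrix (Fin 2) (Fin 2) ℝ => archPlaneLift (p.1 : ℂ) p.2 := by
  have h : ∀ a b : Fin 2, Continuous fun r : Matrix (Fin 2) (Fin 2) ℝ => ((r a b : ℝ) : ℂ) :=
    fun a b => Complex.continuous_ofReal.comp ((continuous_apply b).comp (continuous_apply a))
  have hM : Continuous fun r : Matrix (Fin 2) (Fin 2) ℝ => !![(r 0 0 : ℂ), -I * r 0 1; I * r 1 0, r 1 1] := by
    refine continuous_matrix fun i j => ?_
    fin_cases i <;> fin_cases j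
    · show Continuous fun r : Matrix (Fin 2) (Fin 2) ℝ => ((r 0 0 : ℝ) : ℂ)
      exact h 0 0
    · show Continuous fun r : Matrix (Fin 2) (Fin 2) ℝ => -I * ((r 0 1 : ℝ) : ℂ)
      exact continuous_const.mul (h 0 1)
    · show Continuous fun r : Matrix (Fin 2) (Fin 2) ℝ => I * ((r 1 0 : ℝ) : ℂ)
      exact continuous_const.mul (h 1 0)
    · show Continuous fun r : Matrix (Fin 2) (Fin 2) ℝ => ((r 1 1 : ℝ) : ℂ)
      exact h 1 1
  unfold archPlaneLift
  exact (continuous_subtype_val.comp continuous_fst).smul (hM.comp continuous_snd)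

/-- **`archPlaneLiftMeasure μ`** — the push-forward to `M₂(ℂ)` of `μ ⊗ iwasawaMeasure` (`μ` a measure on `S¹`, ★ `iwasawaMeasure` = the Iwasawa-coordinate Haar
measure of `SL₂(ℝ)` on `M₂(ℝ)`) along `(z, r) ↦ archPlaneLift z r`: for `μ` the Haar probability of `S¹`, a left Haar measure of `U(Φ₂)(ℂ) = S¹ · D SL₂(ℝ) D⁻¹`
carried by the `Φ₂`-unitary matrices (§1 below). [cite: Borel1997, §4.1 (1)–(3)] [cite: BeuzartPlessis2020Asterisque, §1.5 p. 31] -/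
def archPlaneLiftMeasure (μ : Measure Circle) : Measure (Matrix (Fin 2) (Fin 2) ℂ) :=
  Measure.map (fun p : Circle × Matrix (Fin 2) (Fin 2) ℝ => archPlaneLift (p.1 : ℂ) p.2) (μ.prod iwasawaMeasure)

omit [MeasurableSpace (Matrix (Fin 2) (Fin 2) ℝ)] [BorelSpace (Matrix (Fin 2) (Fin 2) ℝ)] [MeasurableSpace Circle] [BorelSpace Circle] in
/-- The HS-ball `{y | Σ‖y_ij‖² ≤ ρ}` of `M₂(ℂ)` is closed, hence measurable. [cite: BeuzartPlessis2020Asterisque, §1.5 p. 31] -/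
theorem measurableSet_hsBall_complex (ρ : ℝ) :
    MeasurableSet {y : Matrix (Fin 2) (Fin 2) ℂ | ∑ i : Fin 2, ∑ j : Fin 2, ‖y i j‖ ^ 2 ≤ ρ} := by
  have hc : Continuous fun y : Matrix (Fin 2) (Fin 2) ℂ => ∑ i : Fin 2, ∑ j : Fin 2, ‖y i j‖ ^ 2 :=
    continuous_finsetSum _ fun i _ => continuous_finsetSum _ fun j _ =>
      (((continuous_apply j).comp (continuous_apply i)).norm).pow 2
  exact (isClosed_le hc continuous_const).measurableSet

omit [MeasurableSpace (Matrix (Fin 2) (Fin 2) ℂ)] [BorelSpace (Matrix (Fin 2) (Fin 2) ℂ)] [MeasurableSpace Circle] [BorelSpace Circle] in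
/-- The HS-ball `{r | Σ r_ij² ≤ ρ}` of `M₂(ℝ)` is closed, hence measurable. [cite: BeuzartPlessis2020Asterisque, §1.5 p. 31] -/
theorem measurableSet_hsBall_real (ρ : ℝ) :
    MeasurableSet {r : Matrix (Fin 2) (Fin 2) ℝ | ∑ i : Fin 2, ∑ j : Fin 2, r i j ^ 2 ≤ ρ} := by
  have hc : Continuous fun r : Matrix (Fin 2) (Fin 2) ℝ => ∑ i : Fin 2, ∑ j : Fin 2, r i j ^ 2 :=
    continuous_finsetSum _ fun i _ => continuous_finsetSum _ fun j _ =>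
      ((continuous_apply j).comp (continuous_apply i)).pow 2
  exact (isClosed_le hc continuous_const).measurableSet

/-- **EXACT HS-BALL FORMULA**: `archPlaneLiftMeasure μ {y | Σ‖y_ij‖² ≤ ρ} = μ(S¹) · iwasawaMeasure {r | Σ r_ij² ≤ ρ}` — the lift preserves the Hilbert–Schmidt norm
(★ `hs_archPlaneLift`), so the preimage of a complex HS-ball is `S¹ ×` the real HS-ball of the same radius; hence every volume-growth bound for the HS-balls of
`SL₂(ℝ)` (LH3-p04's (VOL-grp-SL2)) is inherited with the same exponent. [cite: BeuzartPlessis2020Asterisque, §1.5 (1.5.2)–(1.5.3) p. 31] -/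
theorem archPlaneLiftMeasure_hsBall (μ : Measure Circle) [SFinite μ] (ρ : ℝ) :
    archPlaneLiftMeasure μ {y : Matrix (Fin 2) (Fin 2) ℂ | ∑ i : Fin 2, ∑ j : Fin 2, ‖y i j‖ ^ 2 ≤ ρ} =
      μ Set.univ * iwasawaMeasure {r : Matrix (Fin 2) (Fin 2) ℝ | ∑ i : Fin 2, ∑ j : Fin 2, r i j ^ 2 ≤ ρ} := by
  haveI : SFinite (iwasawaMeasure : Measure (Matrix (Fin 2) (Fin 2) ℝ)) := by
    unfold iwasawaMeasure; infer_instance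
  rw [archPlaneLiftMeasure, Measure.map_apply continuous_archPlaneLift_uncurry.measurable (measurableSet_hsBall_complex ρ)]
  have hpre : (fun p : Circle × Matrix (Fin 2) (Fin 2) ℝ => archPlaneLift (p.1 : ℂ) p.2) ⁻¹'
      {y : Matrix (Fin 2) (Fin 2) ℂ | ∑ i : Fin 2, ∑ j : Fin 2, ‖y i j‖ ^ 2 ≤ ρ} =
      (Set.univ : Set Circle) ×ˢ {r : Matrix (Fin 2) (Fin 2) ℝ | ∑ i : Fin 2, ∑ j : Fin 2, r i j ^ 2 ≤ ρ} := by
    ext p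
    simp only [Set.mem_preimage, Set.mem_setOf_eq, Set.mem_prod, Set.mem_univ, true_and]
    rw [hs_archPlaneLift (Circle.norm_coe p.1)]
  rw [hpre, Measure.prod_prod]

/-- **LEFT INVARIANCE UNDER `U(Φ₂)(ℂ)`**: for `|z₀| = 1` (`z₀ ∈ S¹`) and `det r₀ = 1`, left multiplication by the lift `archPlaneLift z₀ r₀` preserves
`archPlaneLiftMeasure μ` when `μ` is left invariant on `S¹` (★ `map_mul_left_iwasawaMeasure` on the `SL₂(ℝ)` factor, multiplicativity ★ `archPlaneLift_mul`). With
★ `exists_archPlaneLift_eq_of_unitary` this is invariance under every `Φ₂`-unitary matrix. [cite: Borel1997, §4.1 (1)–(3)] -/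
theorem map_mul_left_archPlaneLiftMeasure (μ : Measure Circle) [SFinite μ] [μ.IsMulLeftInvariant] (z₀ : Circle)
    {r₀ : Matrix (Fin 2) (Fin 2) ℝ} (hr₀ : r₀.det = 1) :
    Measure.map (fun y : Matrix (Fin 2) (Fin 2) ℂ => archPlaneLift (z₀ : ℂ) r₀ * y) (archPlaneLiftMeasure μ) = archPlaneLiftMeasure μ := by
  haveI : SFinite (iwasawaMeasure : Measure (Matrix (Fin 2) (Fin 2) ℝ)) := by
    unfold iwasawaMeasure; infer_instance
  have hmul : Measurable fun y : Matrix (Fin 2) (Fin 2) ℂ => archPlaneLift (z₀ : ℂ) r₀ * y :=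
    (continuous_const.matrix_mul continuous_id).measurable
  have hT : Measurable fun p : Circle × Matrix (Fin 2) (Fin 2) ℝ => (z₀ * p.1, r₀ * p.2) :=
    ((continuous_const.mul continuous_fst).prodMk ((continuous_const.matrix_mul continuous_id).comp continuous_snd)).measurable
  rw [archPlaneLiftMeasure, Measure.map_map hmul continuous_archPlaneLift_uncurry.measurable]
  have hcomp : (fun y : Matrix (Fin 2) (Fin 2) ℂ => archPlaneLift (z₀ : ℂ) r₀ * y) ∘
      (fun p : Circle × Matrix (Fin 2) (Fin 2) ℝ => archPlaneLift (p.1 : ℂ) p.2) =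
      (fun p : Circle × Matrix (Fin 2) (Fin 2) ℝ => archPlaneLift (p.1 : ℂ) p.2) ∘
        fun p : Circle × Matrix (Fin 2) (Fin 2) ℝ => (z₀ * p.1, r₀ * p.2) := by
    funext p
    simp only [Function.comp_apply, Circle.coe_mul, archPlaneLift_mul]
  rw [hcomp, ← Measure.map_map continuous_archPlaneLift_uncurry.measurable hT]
  congr 1
  have hprod : (fun p : Circle × Matrix (Fin 2) (Fin 2) ℝ => (z₀ * p.1, r₀ * p.2)) = Prod.map (fun z => z₀ * z) fun g => r₀ * g := rfl
  rw [hprod, ← Measure.map_prod_map _ _ (measurable_const_mul z₀) (measurable_mul_left r₀), map_mul_left_eq_self,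
    map_mul_left_iwasawaMeasure ⟨r₀, hr₀⟩]

omit [MeasurableSpace (Matrix (Fin 2) (Fin 2) ℝ)] [BorelSpace (Matrix (Fin 2) (Fin 2) ℝ)] [MeasurableSpace Circle] [BorelSpace Circle] in
/-- The set of `Φ₂`-unitary matrices is closed, hence measurable. [cite: Rogawski1990, §3.1 p. 19] -/
theorem measurableSet_archPlane_unitary :
    MeasurableSet {y : Matrix (Fin 2) (Fin 2) ℂ |
      (y.map (starRingEnd ℂ))ᵀ * (Matrix.of fun i j : Fin 2 => if i.val + j.val + 1 = 2 then (1 : ℂ) else 0) * y =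
        (Matrix.of fun i j : Fin 2 => if i.val + j.val + 1 = 2 then (1 : ℂ) else 0)} := by
  have hc : Continuous fun y : Matrix (Fin 2) (Fin 2) ℂ =>
      (y.map (starRingEnd ℂ))ᵀ * (Matrix.of fun i j : Fin 2 => if i.val + j.val + 1 = 2 then (1 : ℂ) else 0) * y :=
    ((continuous_id.matrix_map Complex.continuous_conj).matrix_transpose.matrix_mul continuous_const).matrix_mul continuous_id
  exact (isClosed_eq hc continuous_const).measurableSet

/-- **`archPlaneLiftMeasure μ` IS CARRIED BY `U(Φ₂)(ℂ)`**: the complement of the `Φ₂`-unitary matrices is null (★ `iwasawaMeasure` is carried by `SL₂(ℝ)`,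
★ `iwasawaMeasure_compl_det_one`; lifts of `S¹ × SL₂(ℝ)` are `Φ₂`-unitary, ★ `archPlaneLift_unitary`). [cite: Rogawski1990, §3.1 p. 19] [cite: Borel1997, §4.1 (1)–(3)] -/
theorem archPlaneLiftMeasure_compl_unitary (μ : Measure Circle) [SFinite μ] :
    archPlaneLiftMeasure μ {y : Matrix (Fin 2) (Fin 2) ℂ |
      (y.map (starRingEnd ℂ))ᵀ * (Matrix.of fun i j : Fin 2 => if i.val + j.val + 1 = 2 then (1 : ℂ) else 0) * y =
        (Matrix.of fun i j : Fin 2 => if i.val + j.val + 1 = 2 then (1 : ℂ) else 0)}ᶜ = 0 := by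
  haveI : SFinite (iwasawaMeasure : Measure (Matrix (Fin 2) (Fin 2) ℝ)) := by
    unfold iwasawaMeasure; infer_instance
  rw [archPlaneLiftMeasure, Measure.map_apply continuous_archPlaneLift_uncurry.measurable measurableSet_archPlane_unitary.compl]
  refine measure_mono_null (t := (Set.univ : Set Circle) ×ˢ {r : Matrix (Fin 2) (Fin 2) ℝ | r.det = 1}ᶜ) ?_ ?_
  · intro p hp
    simp only [Set.mem_preimage, Set.mem_compl_iff, Set.mem_setOf_eq] at hp
    refine ⟨Set.mem_univ _, fun hdet => hp ?_⟩
    exact archPlaneLift_unitary (Circle.norm_coe p.1) hdet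
  · rw [Measure.prod_prod, iwasawaMeasure_compl_det_one, mul_zero]

end Ambient

end Literature.NumberTheory.Rogawski1990

end
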